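import Literature.Barriers.SmoothPoincare4.ExoticContractibleProofs
import Literature.Topology.FourManifolds.CorkDecomposition
import Literature.Topology.FourManifolds.HCobordism
import Literature.Geometry.Manifold.EmbeddingRangeDiffeomorph
import HarnessLib

/-!
# `RelativeContractibleBarrierFour` from tree leaves: exotic pair, cork theorem, gluing, Freedman

Second sibling proof file of `Literature/Barriers/SmoothPoincare4/ExoticContractible.lean`
(barrier `Literature.Barriers.RelativeContractibleBarrierFour := ¬ RelativeContractibleRigidityFour`,
equivalent to the cork fact `akbulut1991_mazurCork` by
`relativeContractibleBarrierFour_iff_mazurCork` of `ExoticContractibleProofs.lean`).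

The historical proof that corks exist (Akbulut 1991: the Mazur cork, via Donaldson invariants of
a specific pair) is vendored in `ExoticContractibleProofs.lean` as the smooth leaf
`akbulut1991_notExtendsToDiffeomorph`. This file proves the existence of a cork — hence the
barrier — along the OTHER printed route, all of whose leaves are named facts the tree already
has, so that no new leaf is introduced:

> "The following general theorem was first proved independently by Matveyev [M],
> Curtis-Freedman-Hsiang-Stong [C] ...: For every homeomorphic but non-diffeomorphic pair of
> simply connected closed 4-manifolds, one is obtained from the other by removing a contractible
> 4-manifold and gluing it via an involution on the boundary. Such a contractible 4-manifold has
> since been called a Cork." (Akbulut–Yasui 2008, §1)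

Formally (all arrows proved here, at the universe of the exotic pair):

* `SPC4.exists_isHCobordant_isEmpty_diffeomorph_four` (Donaldson 1987 with Freedman and Wall:
  h-cobordant, non-diffeomorphic simply connected closed smooth 4-manifolds `M`, `N` exist;
  tree fact, `HCobordism.lean`),
* `Matveyev1996_decomposition` (the cork theorem in Matveyev's two-piece form:
  `M = W₁ ∪_{φ₁} Q`, `N = W₂ ∪_{φ₂} Q` with `W₁ ≅ W₂` compact contractible; tree fact,
  `CorkDecomposition.lean`),
* `nonempty_diffeomorph_of_isBoundaryGluing` (a gluing `C ∪_φ W` is determined up to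
  diffeomorphism by `φ`; Hirsch 1976, Thm. 8.2.1; tree fact, `Gluing.lean`, used here through its
  universal closure in dimension 4, hypothesis `hU`),

give a compact contractible smooth `C = W₁` and a self-diffeomorphism `τ = φ₁⁻¹ ∘ φ₂ ∘ ∂g` of
`∂C` with `M = C ∪_{φ₁} Q`, `N = C ∪_{φ₁ ∘ τ} Q` (`IsBoundaryGluing.transfer` along the
diffeomorphism `g : W₁ ≅ W₂`); if `τ` were the restriction of a self-diffeomorphism `G` of `C`,
transporting the first gluing along `G` would exhibit `M` too as `C ∪_{φ₁ ∘ τ} Q`, whence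
`M ≅ N` by gluing uniqueness — a contradiction (`nonempty_diffeomorph_of_extendsToDiffeomorph`,
the folklore "twisting by a diffeomorphism that extends over the piece changes nothing"). So
`τ` extends to no self-diffeomorphism of `C`
(`exists_not_extendsToDiffeomorph_of_corkTheorem`): the smooth content of a cork, WITHOUT the
involutivity refinement (Akbulut–Matveyev 1998; not in the tree's `corkDecomposition` either).
With

* `freedmanQuinn1990_homeomorph_extends_contractible` (every boundary diffeomorphism of a compact
  contractible 4-manifold extends to a self-homeomorphism; tree fact,
  `ExoticContractibleProofs.lean`)

this yields `akbulut1991_mazurCork` (`akbulut1991_mazurCork_of_corkTheorem`) and the barrier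
(`relativeContractibleBarrierFour_of_corkTheorem`). Because the exotic-pair fact is stated with
`M N : Type`, the assembled conclusions live in universe `0`; the construction itself
(`exists_not_extendsToDiffeomorph_of_exoticPair`) is universe polymorphic in the pair.

## Scope of the barrier inside the standard sphere (barrier audit, 2026-08-16)

The barrier is an EXISTENCE statement and its technique class is the UNIVERSAL relative
rigidity statement; the last section records, as theorems from tree facts, where the relative
exotica it asserts already live: inside the standard `𝕊 4`. Matveyev's Fact 1 (arXiv p. 3: *"If
`W₁`, `W₂` are homotopy balls built in the proof of the first part of Theorem and `S⁴` is a
4-dimensional sphere with standard smooth structure, then `W₁ #_Σ W₁ ≅ S⁴`, `W₁ #_Σ W₂ ≅ S⁴`"*;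
tree fact `Literature.Topology.FourManifolds.Matveyev1996_partOne_and_fact`) presents `𝕊 4` both
as the double `W₁ ∪_{id} W₁` and as the gluing `W₁ ∪_ψ W₂`, `ψ = φ₁ ≫ φ₂⁻¹`, for the cork-theorem
pieces of ANY h-cobordant simply connected pair `M = W₁ ∪_{φ₁} Q`, `N = W₂ ∪_{φ₂} Q`; when
`M ≇ N` the seam map `ψ` extends to no diffeomorphism `W₁ → W₂` (transport and gluing uniqueness
again, `not_exists_diffeomorph_extends_of_isEmpty_diffeomorph`), although by Freedman–Quinn it
extends to a homeomorphism. So (`exists_relExotic_fillings_sphere_of_corkTheorem`) one and the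
same piece `W₁ ⊂ 𝕊 4` has two marked complements, `(W₁, id)` and `(W₂, ψ)`, homeomorphic but not
diffeomorphic rel boundary, and (`exists_knotted_contractible_sphere_of_corkTheorem`) the two
piece embeddings `W₁ ↪ 𝕊 4` are intertwined by no self-diffeomorphism of `𝕊 4` — the cork of an
exotic pair KNOTS in the standard sphere, as Akbulut–Yasui observe for their corks `W_n`:
*"The corks `W_n` can be knotted in `S⁴` with simply connected complements (even PL knotted),
this is because doubling `W_n` both by the identity and by the involution `f_n : ∂W_n → ∂W_n`
give `S⁴` ... Obviously these knotted imbeddings `W_n ⊂ S⁴` are not corks of `S⁴`. It is not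
known whether `S⁴` admits cork imbeddings"* (Akbulut–Yasui 2009, §7.2). Consequences for the
REACH of the barrier, recorded in its `scope_caveats:` / `evasions_known:` lines
(`ExoticContractible.lean`): non-extension of boundary maps over contractible pieces is
compatible with the glued sphere being standard, so the barrier does not bite arguments that
recognise a twisted double / a re-filled sphere as `S⁴` without extending seam maps; conversely
relative exotica of contractible pieces cannot by themselves certify an exotic `S⁴`, while cruxes
asserting uniqueness of marked complements, or of embeddings up to `Diff(S⁴)`, of compact
contractible domains in `S⁴` are refuted relative to these facts.

## References

[AkbulutYasui2008] [Matveyev1996] [CurtisFreedmanHsiangStong1996] [Hirsch1976]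
[FreedmanQuinn1990] [Akbulut1991Fake] [AkbulutYasui2009Knotting] [LeeSmoothManifolds2013]
-/

noncomputable section

open scoped Manifold ContDiff
open Set Function

namespace Literature.Barriers.SmoothPoincare4

universe u

/-! ### Twisting by a boundary diffeomorphism that extends over the piece changes nothing -/

section Extends

variable {C W : Type u} [TopologicalSpace C] [ChartedSpace (EuclideanHalfSpace 4) C]
  [IsManifold (𝓡∂ 4) ∞ C] [TopologicalSpace W] [ChartedSpace (EuclideanHalfSpace 4) W]
  {bC : Literature.Topology.FourManifolds.BoundaryData (𝓡∂ 4) C (𝓡 3)} {bW : Literature.Topology.FourManifolds.BoundaryData (𝓡∂ 4) W (𝓡 3)}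
  {τ : bC.carrier ≃ₘ⟮𝓡 3, 𝓡 3⟯ bC.carrier}

/-- **A cork twist by a boundary diffeomorphism that extends over the cork is trivial.** Let
`X = C ∪_φ W` and `X' = C ∪_{φ ∘ τ} W` be two gluings of compact smooth 4-manifolds with
boundary `C`, `W` (so `X'` is the twist of `X` along `(C, τ)`, cf. `Literature.Topology.FourManifolds.IsCorkTwist`). If `τ`
extends to a self-diffeomorphism of `C` (`ExtendsToDiffeomorph bC τ`), then `X ≅ X'`: both are
gluings along `φ ∘ τ` (transport the first along the extension, the tree's
`IsBoundaryGluing.comp_diffeomorph`), and a gluing is determined by its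
gluing map up to diffeomorphism (tree fact `Literature.Topology.FourManifolds.nonempty_diffeomorph_of_isBoundaryGluing`,
hypothesis `hU`; Hirsch 1976, Thm. 8.2.1). This is why the definition of a cork asks for a
boundary map that does NOT extend to a self-diffeomorphism (Akbulut–Yasui 2008, Def. 2.1).
[cite: Hirsch1976, Thm. 8.2.1] [cite: AkbulutYasui2008, Def. 2.1 (arXiv:0806.3010 §2 numbering)] -/
theorem nonempty_diffeomorph_of_extendsToDiffeomorph
    [T2Space C] [SecondCountableTopology C] [CompactSpace C]
    [T2Space W] [SecondCountableTopology W] [IsManifold (𝓡∂ 4) ∞ W] [CompactSpace W]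
    {X X' : Type u}
    [TopologicalSpace X] [ChartedSpace (EuclideanSpace ℝ (Fin 4)) X] [IsManifold (𝓡 4) ∞ X]
    [TopologicalSpace X'] [ChartedSpace (EuclideanSpace ℝ (Fin 4)) X'] [IsManifold (𝓡 4) ∞ X']
    (hU : Literature.Topology.FourManifolds.nonempty_diffeomorph_of_isBoundaryGluing (bM := bC) (bN := bW) (P := X) (P' := X'))
    {φ : bC.carrier ≃ₘ⟮𝓡 3, 𝓡 3⟯ bW.carrier}
    (hX : Literature.Topology.FourManifolds.IsBoundaryGluing bC bW φ (𝓡 4) X) (hX' : Literature.Topology.FourManifolds.IsBoundaryGluing bC bW (τ.trans φ) (𝓡 4) X')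
    (hE : Literature.Topology.FourManifolds.ExtendsToDiffeomorph bC τ) : Nonempty (X ≃ₘ⟮𝓡 4, 𝓡 4⟯ X') := by
  obtain ⟨G, hG⟩ := hE
  exact hU (hX.comp_diffeomorph G τ.toEquiv hG fun _ => rfl) hX'

/-- Contrapositive form: **an effective twist has a non-extending boundary map.** If
`X = C ∪_φ W` and `X' = C ∪_{φ ∘ τ} W` are NOT diffeomorphic, then `τ` extends to no
self-diffeomorphism of `C`. [cite: Hirsch1976, Thm. 8.2.1] -/
theorem not_extendsToDiffeomorph_of_isEmpty_diffeomorph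
    [T2Space C] [SecondCountableTopology C] [CompactSpace C]
    [T2Space W] [SecondCountableTopology W] [IsManifold (𝓡∂ 4) ∞ W] [CompactSpace W]
    {X X' : Type u}
    [TopologicalSpace X] [ChartedSpace (EuclideanSpace ℝ (Fin 4)) X] [IsManifold (𝓡 4) ∞ X]
    [TopologicalSpace X'] [ChartedSpace (EuclideanSpace ℝ (Fin 4)) X'] [IsManifold (𝓡 4) ∞ X']
    (hU : Literature.Topology.FourManifolds.nonempty_diffeomorph_of_isBoundaryGluing (bM := bC) (bN := bW) (P := X) (P' := X'))
    {φ : bC.carrier ≃ₘ⟮𝓡 3, 𝓡 3⟯ bW.carrier}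
    (hX : Literature.Topology.FourManifolds.IsBoundaryGluing bC bW φ (𝓡 4) X) (hX' : Literature.Topology.FourManifolds.IsBoundaryGluing bC bW (τ.trans φ) (𝓡 4) X')
    (hne : IsEmpty (X ≃ₘ⟮𝓡 4, 𝓡 4⟯ X')) : ¬ Literature.Topology.FourManifolds.ExtendsToDiffeomorph bC τ := fun hE =>
  (nonempty_diffeomorph_of_extendsToDiffeomorph hU hX hX' hE).elim fun e => hne.false e

end Extends

/-! ### A non-extending boundary diffeomorphism from an exotic pair and the cork theorem -/

/-- **Exotic h-cobordant pair + cork theorem + gluing uniqueness ⇒ the smooth content of a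
cork.** Suppose (`hU`) gluings of compact smooth 4-manifolds with boundary are determined by the
gluing map up to diffeomorphism (tree fact `Literature.Topology.FourManifolds.nonempty_diffeomorph_of_isBoundaryGluing`,
universally in dimension 4), (`hM`) Matveyev's decomposition theorem
(`Literature.Topology.FourManifolds.Matveyev1996_decomposition`), and (`hD`) that some simply connected closed smooth
4-manifolds `M`, `N` are h-cobordant but not diffeomorphic. Then there are a compact (Hausdorff,
second countable) contractible smooth 4-manifold `C` with boundary datum `b` and a
self-diffeomorphism `τ` of `∂C` extending to NO self-diffeomorphism of `C`: write
`M = W₁ ∪_{φ₁} Q`, `N = W₂ ∪_{φ₂} Q` with `g : W₁ ≅ W₂` (Matveyev), so `N = W₁ ∪_{φ₂ ∘ ∂g} Q`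
(`IsBoundaryGluing.transfer`); take `C = W₁`, `τ = φ₁⁻¹ ∘ φ₂ ∘ ∂g`; an extension of `τ` over
`C` would give `M ≅ N` (`not_extendsToDiffeomorph_of_isEmpty_diffeomorph`). This is the route
"exotic pair ⇒ cork" of the cork theorem (Akbulut–Yasui 2008, §1: "For every homeomorphic but
non-diffeomorphic pair of simply connected closed 4-manifolds, one is obtained from the other by
removing a contractible 4-manifold and gluing it via an involution on the boundary. Such a
contractible 4-manifold has since been called a Cork."); involutivity of `τ` (Akbulut–Matveyev
1998) is not obtained here. [cite: Matveyev1996, Theorem] [cite: AkbulutYasui2008, §1 (the cork theorem [M], [C])] -/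
theorem exists_not_extendsToDiffeomorph_of_exoticPair
    (hU : ∀ {C W : Type u} [TopologicalSpace C] [T2Space C] [SecondCountableTopology C]
      [ChartedSpace (EuclideanHalfSpace 4) C] [IsManifold (𝓡∂ 4) ∞ C] [CompactSpace C]
      [TopologicalSpace W] [T2Space W] [SecondCountableTopology W]
      [ChartedSpace (EuclideanHalfSpace 4) W] [IsManifold (𝓡∂ 4) ∞ W] [CompactSpace W]
      {bC : Literature.Topology.FourManifolds.BoundaryData (𝓡∂ 4) C (𝓡 3)} {bW : Literature.Topology.FourManifolds.BoundaryData (𝓡∂ 4) W (𝓡 3)}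
      {X X' : Type u}
      [TopologicalSpace X] [ChartedSpace (EuclideanSpace ℝ (Fin 4)) X] [IsManifold (𝓡 4) ∞ X]
      [TopologicalSpace X'] [ChartedSpace (EuclideanSpace ℝ (Fin 4)) X'] [IsManifold (𝓡 4) ∞ X'],
      Literature.Topology.FourManifolds.nonempty_diffeomorph_of_isBoundaryGluing (bM := bC) (bN := bW) (P := X) (P' := X'))
    (hM : Literature.Topology.FourManifolds.Matveyev1996_decomposition.{u})
    (hD : ∃ (M N : Type u) (_ : TopologicalSpace M) (_ : T2Space M) (_ : SecondCountableTopology M)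
      (_ : ChartedSpace (EuclideanSpace ℝ (Fin 4)) M) (_ : IsManifold (𝓡 4) ∞ M)
      (_ : CompactSpace M) (_ : SimplyConnectedSpace M)
      (_ : TopologicalSpace N) (_ : T2Space N) (_ : SecondCountableTopology N)
      (_ : ChartedSpace (EuclideanSpace ℝ (Fin 4)) N) (_ : IsManifold (𝓡 4) ∞ N)
      (_ : CompactSpace N) (_ : SimplyConnectedSpace N),
      Literature.Topology.FourManifolds.IsHCobordant 4 M N ∧ IsEmpty (M ≃ₘ⟮𝓡 4, 𝓡 4⟯ N)) :
    ∃ (C : Type u) (_ : TopologicalSpace C) (_ : T2Space C) (_ : SecondCountableTopology C)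
      (_ : ChartedSpace (EuclideanHalfSpace 4) C) (_ : IsManifold (𝓡∂ 4) ∞ C) (_ : CompactSpace C)
      (_ : ContractibleSpace C) (b : Literature.Topology.FourManifolds.BoundaryData (𝓡∂ 4) C (𝓡 3))
      (τ : b.carrier ≃ₘ⟮𝓡 3, 𝓡 3⟯ b.carrier), ¬ Literature.Topology.FourManifolds.ExtendsToDiffeomorph b τ := by
  obtain ⟨M, N, _, _, _, _, _, _, _, _, _, _, _, _, _, _, hH, hne⟩ := hD
  obtain ⟨W₁, W₂, Q, _, _, _, _, _, _, _, _, _, _, _, _, _, _, _, b₁, b₂, bQ, φ₁, φ₂,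
    hc₁, hC₁, -, -, hcQ, hX₁, hX₂, ⟨g⟩⟩ := hM M N hH
  haveI : CompactSpace W₁ := hc₁
  haveI : ContractibleSpace W₁ := hC₁
  haveI : CompactSpace Q := hcQ
  -- `N = W₂ ∪_{φ₂} Q = W₁ ∪_{φ₂ ∘ ∂g} Q`, and `φ₂ ∘ ∂g = φ₁ ∘ τ` for `τ := φ₁⁻¹ ∘ φ₂ ∘ ∂g`.
  set τ : b₁.carrier ≃ₘ⟮𝓡 3, 𝓡 3⟯ b₁.carrier :=
    ((b₁.restrictDiffeomorph b₂ g).trans φ₂).trans φ₁.symm with hτ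
  have hX₂' : Literature.Topology.FourManifolds.IsBoundaryGluing b₁ bQ (τ.trans φ₁) (𝓡 4) N := by
    refine Literature.Topology.FourManifolds.isBoundaryGluing_congr (fun z => ?_) (hX₂.transfer (b₁ := b₁) g)
    simp only [hτ, Function.comp_apply, Diffeomorph.coe_trans, Diffeomorph.apply_symm_apply]
  exact ⟨W₁, ‹_›, ‹_›, ‹_›, ‹_›, ‹_›, hc₁, hC₁, b₁, τ,
    not_extendsToDiffeomorph_of_isEmpty_diffeomorph hU hX₁ hX₂' hne⟩

/-- **The smooth content of a cork from tree facts**: gluing uniqueness in dimension 4 (`hU`,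
`Literature.Topology.FourManifolds.nonempty_diffeomorph_of_isBoundaryGluing`), Matveyev's cork decomposition theorem (`hM`) and
the Donaldson–Freedman–Wall exotic h-cobordant pair
(`hD : SPC4.exists_isHCobordant_isEmpty_diffeomorph_four`) give a compact contractible smooth
4-manifold with a boundary diffeomorphism extending to no self-diffeomorphism (universe `0`, that
of the exotic-pair fact). [cite: Matveyev1996, Theorem] [cite: AkbulutYasui2008, §1 (the cork theorem [M], [C])] -/
theorem exists_not_extendsToDiffeomorph_of_corkTheorem
    (hU : ∀ {C W : Type} [TopologicalSpace C] [T2Space C] [SecondCountableTopology C]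
      [ChartedSpace (EuclideanHalfSpace 4) C] [IsManifold (𝓡∂ 4) ∞ C] [CompactSpace C]
      [TopologicalSpace W] [T2Space W] [SecondCountableTopology W]
      [ChartedSpace (EuclideanHalfSpace 4) W] [IsManifold (𝓡∂ 4) ∞ W] [CompactSpace W]
      {bC : Literature.Topology.FourManifolds.BoundaryData (𝓡∂ 4) C (𝓡 3)} {bW : Literature.Topology.FourManifolds.BoundaryData (𝓡∂ 4) W (𝓡 3)}
      {X X' : Type}
      [TopologicalSpace X] [ChartedSpace (EuclideanSpace ℝ (Fin 4)) X] [IsManifold (𝓡 4) ∞ X]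
      [TopologicalSpace X'] [ChartedSpace (EuclideanSpace ℝ (Fin 4)) X'] [IsManifold (𝓡 4) ∞ X'],
      Literature.Topology.FourManifolds.nonempty_diffeomorph_of_isBoundaryGluing (bM := bC) (bN := bW) (P := X) (P' := X'))
    (hM : Literature.Topology.FourManifolds.Matveyev1996_decomposition.{0})
    (hD : Literature.Topology.FourManifolds.exists_isHCobordant_isEmpty_diffeomorph_four) :
    ∃ (C : Type) (_ : TopologicalSpace C) (_ : T2Space C) (_ : SecondCountableTopology C)
      (_ : ChartedSpace (EuclideanHalfSpace 4) C) (_ : IsManifold (𝓡∂ 4) ∞ C) (_ : CompactSpace C)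
      (_ : ContractibleSpace C) (b : Literature.Topology.FourManifolds.BoundaryData (𝓡∂ 4) C (𝓡 3))
      (τ : b.carrier ≃ₘ⟮𝓡 3, 𝓡 3⟯ b.carrier), ¬ Literature.Topology.FourManifolds.ExtendsToDiffeomorph b τ :=
  exists_not_extendsToDiffeomorph_of_exoticPair hU hM hD

/-! ### Assembly: the cork fact and the relative barrier from tree facts -/

/-- **Corks exist (the fact `akbulut1991_mazurCork`) from tree facts**: the smooth content
(`exists_not_extendsToDiffeomorph_of_corkTheorem`, from `hU`, `hM`, `hD`) and Freedman–Quinn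
(`hF`: the boundary diffeomorphism extends to a self-homeomorphism,
`extendsToHomeomorph_of_freedmanQuinn`). The witness is a cork of the Donaldson pair, not
necessarily Akbulut's Mazur cork (the fact is an existence statement).
[cite: AkbulutYasui2008, §1 (the cork theorem [M], [C])] [cite: FreedmanQuinn1990, Prop. 11.1C (trivial group)] -/
theorem akbulut1991_mazurCork_of_corkTheorem
    (hU : ∀ {C W : Type} [TopologicalSpace C] [T2Space C] [SecondCountableTopology C]
      [ChartedSpace (EuclideanHalfSpace 4) C] [IsManifold (𝓡∂ 4) ∞ C] [CompactSpace C]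
      [TopologicalSpace W] [T2Space W] [SecondCountableTopology W]
      [ChartedSpace (EuclideanHalfSpace 4) W] [IsManifold (𝓡∂ 4) ∞ W] [CompactSpace W]
      {bC : Literature.Topology.FourManifolds.BoundaryData (𝓡∂ 4) C (𝓡 3)} {bW : Literature.Topology.FourManifolds.BoundaryData (𝓡∂ 4) W (𝓡 3)}
      {X X' : Type}
      [TopologicalSpace X] [ChartedSpace (EuclideanSpace ℝ (Fin 4)) X] [IsManifold (𝓡 4) ∞ X]
      [TopologicalSpace X'] [ChartedSpace (EuclideanSpace ℝ (Fin 4)) X'] [IsManifold (𝓡 4) ∞ X'],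
      Literature.Topology.FourManifolds.nonempty_diffeomorph_of_isBoundaryGluing (bM := bC) (bN := bW) (P := X) (P' := X'))
    (hM : Literature.Topology.FourManifolds.Matveyev1996_decomposition.{0})
    (hD : Literature.Topology.FourManifolds.exists_isHCobordant_isEmpty_diffeomorph_four)
    (hF : freedmanQuinn1990_homeomorph_extends_contractible.{0}) :
    akbulut1991_mazurCork.{0} := by
  obtain ⟨C, _, _, _, _, _, _, _, b, τ, hτ⟩ :=
    exists_not_extendsToDiffeomorph_of_corkTheorem hU hM hD
  exact ⟨C, ‹_›, ‹_›, ‹_›, ‹_›, ‹_›, ‹_›, ‹_›, b, τ,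
    extendsToHomeomorph_of_freedmanQuinn hF b τ, hτ⟩

/-- **`RelativeContractibleBarrierFour` (universe `0`) from four named facts already in the
tree** — gluing uniqueness (Hirsch), Matveyev's cork decomposition, the Donaldson–Freedman–Wall
exotic h-cobordant pair, Freedman–Quinn — through `akbulut1991_mazurCork_of_corkTheorem` and
`relativeContractibleBarrierFour_of_akbulut`. No leaf specific to this barrier remains: its
discharge is reduced to the discharge of those four facts.
[cite: AkbulutYasui2008, §1 (the cork theorem [M], [C])] [cite: AkbulutRuberman2016, §1] -/
theorem relativeContractibleBarrierFour_of_corkTheorem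
    (hU : ∀ {C W : Type} [TopologicalSpace C] [T2Space C] [SecondCountableTopology C]
      [ChartedSpace (EuclideanHalfSpace 4) C] [IsManifold (𝓡∂ 4) ∞ C] [CompactSpace C]
      [TopologicalSpace W] [T2Space W] [SecondCountableTopology W]
      [ChartedSpace (EuclideanHalfSpace 4) W] [IsManifold (𝓡∂ 4) ∞ W] [CompactSpace W]
      {bC : Literature.Topology.FourManifolds.BoundaryData (𝓡∂ 4) C (𝓡 3)} {bW : Literature.Topology.FourManifolds.BoundaryData (𝓡∂ 4) W (𝓡 3)}
      {X X' : Type}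
      [TopologicalSpace X] [ChartedSpace (EuclideanSpace ℝ (Fin 4)) X] [IsManifold (𝓡 4) ∞ X]
      [TopologicalSpace X'] [ChartedSpace (EuclideanSpace ℝ (Fin 4)) X'] [IsManifold (𝓡 4) ∞ X'],
      Literature.Topology.FourManifolds.nonempty_diffeomorph_of_isBoundaryGluing (bM := bC) (bN := bW) (P := X) (P' := X'))
    (hM : Literature.Topology.FourManifolds.Matveyev1996_decomposition.{0})
    (hD : Literature.Topology.FourManifolds.exists_isHCobordant_isEmpty_diffeomorph_four)
    (hF : freedmanQuinn1990_homeomorph_extends_contractible.{0}) :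
    RelativeContractibleBarrierFour.{0} :=
  relativeContractibleBarrierFour_of_akbulut (akbulut1991_mazurCork_of_corkTheorem hU hM hD hF)

/-! ### Scope of the barrier inside the standard sphere: relatively exotic contractible fillings of `𝕊 4` and knotted corks (audit 2026-08-16)

Two-piece form of the argument of `not_extendsToDiffeomorph_of_isEmpty_diffeomorph`, then
Matveyev's Fact 1 (`Literature.Topology.FourManifolds.Matveyev1996_partOne_and_fact`: part 1 of
his Theorem together with *"`W₁ #_Σ W₁ ≅ S⁴`, `W₁ #_Σ W₂ ≅ S⁴`"*, arXiv p. 3) in place of part 2: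
the relative exoticity produced by the cork theorem from an exotic pair is realised by two
contractible fillings of one piece OF THE STANDARD SPHERE, and the corresponding embeddings
`W₁ ↪ 𝕊 4` are knotted (Akbulut–Yasui 2009, §7.2). No fact is introduced; the sphere `𝕊 4` is
Mathlib's unit sphere of `ℝ⁵` with its smooth structure, as in `CorkDecomposition.lean`. -/

section TwoPiece

variable {W₁ W₂ Q : Type u}
  [TopologicalSpace W₁] [ChartedSpace (EuclideanHalfSpace 4) W₁] [IsManifold (𝓡∂ 4) ∞ W₁]
  [TopologicalSpace W₂] [ChartedSpace (EuclideanHalfSpace 4) W₂] [IsManifold (𝓡∂ 4) ∞ W₂]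
  [TopologicalSpace Q] [ChartedSpace (EuclideanHalfSpace 4) Q]
  {b₁ : Literature.Topology.FourManifolds.BoundaryData (𝓡∂ 4) W₁ (𝓡 3)}
  {b₂ : Literature.Topology.FourManifolds.BoundaryData (𝓡∂ 4) W₂ (𝓡 3)}
  {bQ : Literature.Topology.FourManifolds.BoundaryData (𝓡∂ 4) Q (𝓡 3)}

/-- **Transport of a gluing along a diffeomorphism of pieces with prescribed seam.** If
`P = W₂ ∪_{φ₂} Q` and `G : W₁ ≅ W₂` restricts on the boundary to a map `ψ` with `φ₂ ∘ ψ = φ₁`,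
then `P = W₁ ∪_{φ₁} Q` (the tree's `IsBoundaryGluing.transfer`, whose re-indexed seam
`φ₂ ∘ ∂G` equals `φ₁` because `∂G = ψ` by injectivity of `b₂.incl`). Two-piece analogue of
`IsBoundaryGluing.comp_diffeomorph`; Hirsch 1976, §8.2. [cite: HirschDT1976, Thm. 8.2.1] -/
theorem isBoundaryGluing_of_diffeomorph_extends
    {P : Type*} [TopologicalSpace P] [ChartedSpace (EuclideanSpace ℝ (Fin 4)) P]
    {φ₁ : b₁.carrier ≃ₘ⟮𝓡 3, 𝓡 3⟯ bQ.carrier} {φ₂ : b₂.carrier ≃ₘ⟮𝓡 3, 𝓡 3⟯ bQ.carrier}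
    {ψ : b₁.carrier → b₂.carrier} (G : W₁ ≃ₘ⟮𝓡∂ 4, 𝓡∂ 4⟯ W₂)
    (hG : ∀ x, G (b₁.incl x) = b₂.incl (ψ x)) (hψ : ∀ x, φ₂ (ψ x) = φ₁ x)
    (h : Literature.Topology.FourManifolds.IsBoundaryGluing b₂ bQ φ₂ (𝓡 4) P) :
    Literature.Topology.FourManifolds.IsBoundaryGluing b₁ bQ φ₁ (𝓡 4) P := by
  refine Literature.Topology.FourManifolds.isBoundaryGluing_congr (fun z => ?_) (h.transfer (b₁ := b₁) G)
  have hz : b₁.restrictDiffeomorph b₂ G z = ψ z := by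
    apply b₂.injective_incl
    rw [Literature.Topology.FourManifolds.BoundaryData.incl_restrictDiffeomorph, hG]
  rw [Function.comp_apply, hz, hψ]

/-- **An effective two-piece twist has a seam map extending to no diffeomorphism of the
pieces.** If `X = W₁ ∪_{φ₁} Q` and `X' = W₂ ∪_{φ₂} Q` are NOT diffeomorphic and gluings along a
common boundary map are unique (`hU`, tree fact
`Literature.Topology.FourManifolds.nonempty_diffeomorph_of_isBoundaryGluing`; Hirsch 1976,
Thm. 8.2.1), then no diffeomorphism `G : W₁ ≅ W₂` restricts on `∂W₁` to a `ψ` with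
`φ₂ ∘ ψ = φ₁` (e.g. `ψ = φ₁ ≫ φ₂⁻¹`): otherwise `X'` would also be `W₁ ∪_{φ₁} Q`
(`isBoundaryGluing_of_diffeomorph_extends`) and `X ≅ X'`. With `W₁ = W₂`, `φ₂ = φ₁ ∘ τ`,
`ψ = τ` this is `not_extendsToDiffeomorph_of_isEmpty_diffeomorph`. [cite: HirschDT1976, Thm. 8.2.1] -/
theorem not_exists_diffeomorph_extends_of_isEmpty_diffeomorph
    {X X' : Type u}
    [TopologicalSpace X] [ChartedSpace (EuclideanSpace ℝ (Fin 4)) X]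
    [TopologicalSpace X'] [ChartedSpace (EuclideanSpace ℝ (Fin 4)) X']
    (hU : Literature.Topology.FourManifolds.nonempty_diffeomorph_of_isBoundaryGluing
      (bM := b₁) (bN := bQ) (P := X) (P' := X'))
    {φ₁ : b₁.carrier ≃ₘ⟮𝓡 3, 𝓡 3⟯ bQ.carrier} {φ₂ : b₂.carrier ≃ₘ⟮𝓡 3, 𝓡 3⟯ bQ.carrier}
    (hX : Literature.Topology.FourManifolds.IsBoundaryGluing b₁ bQ φ₁ (𝓡 4) X)
    (hX' : Literature.Topology.FourManifolds.IsBoundaryGluing b₂ bQ φ₂ (𝓡 4) X')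
    (hne : IsEmpty (X ≃ₘ⟮𝓡 4, 𝓡 4⟯ X'))
    {ψ : b₁.carrier → b₂.carrier} (hψ : ∀ x, φ₂ (ψ x) = φ₁ x) :
    ¬ ∃ G : W₁ ≃ₘ⟮𝓡∂ 4, 𝓡∂ 4⟯ W₂, ∀ x, G (b₁.incl x) = b₂.incl (ψ x) := by
  rintro ⟨G, hG⟩
  obtain ⟨e⟩ := hU hX (isBoundaryGluing_of_diffeomorph_extends G hG hψ hX')
  exact hne.false e

end TwoPiece

/-- **Relatively exotic contractible fillings inside the standard 4-sphere** (universe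
polymorphic in the exotic pair). Suppose (`hU`) gluings of compact smooth 4-manifolds with
boundary are determined by the gluing map, (`hB`) Matveyev's Theorem part 1 with his Fact 1
(`Literature.Topology.FourManifolds.Matveyev1996_partOne_and_fact`), (`hF`) Freedman–Quinn
11.1C, and (`hD`) some simply connected closed smooth `M`, `N` are h-cobordant but not
diffeomorphic. Then there are compact (Hausdorff, second countable) contractible smooth
4-manifolds `W₁`, `W₂` with boundary data `b₁`, `b₂` and a diffeomorphism `ψ : ∂W₁ ≅ ∂W₂` such
that: `ψ` extends to a HOMEOMORPHISM `W₁ → W₂`; `ψ` extends to NO DIFFEOMORPHISM `W₁ → W₂`; and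
the standard sphere `𝕊 4` is both the double `W₁ ∪_{id} W₁` and the gluing `W₁ ∪_ψ W₂`. Proof:
`M = W₁ ∪_{φ₁} Q`, `N = W₂ ∪_{φ₂} Q`, `𝕊 4 = W₁ ∪_{id} W₁ = W₁ ∪_{φ₁ ≫ φ₂⁻¹} W₂` (Matveyev,
arXiv p. 3, Fact 1: *"`W₁ #_Σ W₁ ≅ S⁴`, `W₁ #_Σ W₂ ≅ S⁴`"*); take `ψ = φ₁ ≫ φ₂⁻¹`; a diffeomorphic
extension would make `N` a gluing `W₁ ∪_{φ₁} Q`, so `M ≅ N`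
(`not_exists_diffeomorph_extends_of_isEmpty_diffeomorph`); the homeomorphic extension is `hF`.
In words: the piece `W₁ ⊂ 𝕊 4` has two marked complements `(W₁, id)`, `(W₂, ψ)` which are
homeomorphic but not diffeomorphic rel boundary — the relative exotica asserted by
`RelativeContractibleBarrierFour` occur among contractible pieces OF THE STANDARD SPHERE, so
non-extension of seam maps over contractible pieces is no evidence against, and no obstruction
to, the glued sphere being standard (Akbulut–Yasui 2009, §7.2: *"doubling `W_n` both by the
identity and by the involution `f_n` ... give `S⁴` ... Obviously these knotted imbeddings
`W_n ⊂ S⁴` are not corks of `S⁴`"*).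
[cite: Matveyev1996, Theorem 1 part 1 and Fact 1 (arXiv:dg-ga/9505001 pp. 1, 3)]
[cite: AkbulutYasui2009Knotting, §7.2 (arXiv:0812.5098)]
[cite: FreedmanQuinn1990, Prop. 11.1C (trivial group)] -/
theorem exists_relExotic_fillings_sphere_of_partOneFact
    (hU : ∀ {C W : Type u} [TopologicalSpace C] [T2Space C] [SecondCountableTopology C]
      [ChartedSpace (EuclideanHalfSpace 4) C] [IsManifold (𝓡∂ 4) ∞ C] [CompactSpace C]
      [TopologicalSpace W] [T2Space W] [SecondCountableTopology W]
      [ChartedSpace (EuclideanHalfSpace 4) W] [IsManifold (𝓡∂ 4) ∞ W] [CompactSpace W]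
      {bC : Literature.Topology.FourManifolds.BoundaryData (𝓡∂ 4) C (𝓡 3)} {bW : Literature.Topology.FourManifolds.BoundaryData (𝓡∂ 4) W (𝓡 3)}
      {X X' : Type u}
      [TopologicalSpace X] [ChartedSpace (EuclideanSpace ℝ (Fin 4)) X] [IsManifold (𝓡 4) ∞ X]
      [TopologicalSpace X'] [ChartedSpace (EuclideanSpace ℝ (Fin 4)) X'] [IsManifold (𝓡 4) ∞ X'],
      Literature.Topology.FourManifolds.nonempty_diffeomorph_of_isBoundaryGluing (bM := bC) (bN := bW) (P := X) (P' := X'))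
    (hB : Literature.Topology.FourManifolds.Matveyev1996_partOne_and_fact.{u})
    (hF : freedmanQuinn1990_homeomorph_extends_contractible.{u})
    (hD : ∃ (M N : Type u) (_ : TopologicalSpace M) (_ : T2Space M) (_ : SecondCountableTopology M)
      (_ : ChartedSpace (EuclideanSpace ℝ (Fin 4)) M) (_ : IsManifold (𝓡 4) ∞ M)
      (_ : CompactSpace M) (_ : SimplyConnectedSpace M)
      (_ : TopologicalSpace N) (_ : T2Space N) (_ : SecondCountableTopology N)
      (_ : ChartedSpace (EuclideanSpace ℝ (Fin 4)) N) (_ : IsManifold (𝓡 4) ∞ N)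
      (_ : CompactSpace N) (_ : SimplyConnectedSpace N),
      Literature.Topology.FourManifolds.IsHCobordant 4 M N ∧ IsEmpty (M ≃ₘ⟮𝓡 4, 𝓡 4⟯ N)) :
    ∃ (W₁ W₂ : Type u)
      (_ : TopologicalSpace W₁) (_ : T2Space W₁) (_ : SecondCountableTopology W₁)
      (_ : ChartedSpace (EuclideanHalfSpace 4) W₁) (_ : IsManifold (𝓡∂ 4) ∞ W₁)
      (_ : CompactSpace W₁) (_ : ContractibleSpace W₁)
      (_ : TopologicalSpace W₂) (_ : T2Space W₂) (_ : SecondCountableTopology W₂)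
      (_ : ChartedSpace (EuclideanHalfSpace 4) W₂) (_ : IsManifold (𝓡∂ 4) ∞ W₂)
      (_ : CompactSpace W₂) (_ : ContractibleSpace W₂)
      (b₁ : Literature.Topology.FourManifolds.BoundaryData (𝓡∂ 4) W₁ (𝓡 3))
      (b₂ : Literature.Topology.FourManifolds.BoundaryData (𝓡∂ 4) W₂ (𝓡 3))
      (ψ : b₁.carrier ≃ₘ⟮𝓡 3, 𝓡 3⟯ b₂.carrier),
      (∃ Φ : W₁ ≃ₜ W₂, ∀ x, Φ (b₁.incl x) = b₂.incl (ψ x)) ∧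
      (¬ ∃ G : W₁ ≃ₘ⟮𝓡∂ 4, 𝓡∂ 4⟯ W₂, ∀ x, G (b₁.incl x) = b₂.incl (ψ x)) ∧
      Literature.Topology.FourManifolds.IsDouble b₁ (𝓡 4) (Metric.sphere (0 : EuclideanSpace ℝ (Fin (4 + 1))) 1) ∧
      Literature.Topology.FourManifolds.IsBoundaryGluing b₁ b₂ ψ (𝓡 4) (Metric.sphere (0 : EuclideanSpace ℝ (Fin (4 + 1))) 1) := by
  obtain ⟨M, N, _, _, _, _, _, _, _, _, _, _, _, _, _, _, hH, hne⟩ := hD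
  obtain ⟨W₁, W₂, Q, _, _, _, _, _, _, _, _, _, _, _, _, _, _, _, b₁, b₂, bQ, φ₁, φ₂,
    hc₁, hk₁, hc₂, hk₂, hcQ, hX₁, hX₂, hDbl, hS⟩ := hB M N hH
  haveI : CompactSpace W₁ := hc₁
  haveI : ContractibleSpace W₁ := hk₁
  haveI : CompactSpace W₂ := hc₂
  haveI : ContractibleSpace W₂ := hk₂
  haveI : CompactSpace Q := hcQ
  have hψ : ∀ x, φ₂ ((φ₁.trans φ₂.symm) x) = φ₁ x := fun x => by simp
  refine ⟨W₁, W₂, ‹_›, ‹_›, ‹_›, ‹_›, ‹_›, hc₁, hk₁, ‹_›, ‹_›, ‹_›, ‹_›, ‹_›, hc₂, hk₂, b₁, b₂,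
    φ₁.trans φ₂.symm, ?_, ?_, hDbl, hS⟩
  · obtain ⟨Φ, hΦ⟩ := hF W₁ W₂ b₁ b₂ (φ₁.trans φ₂.symm).toHomeomorph
    exact ⟨Φ, hΦ⟩
  · exact not_exists_diffeomorph_extends_of_isEmpty_diffeomorph hU hX₁ hX₂ hne hψ

/-- **Relatively exotic contractible fillings inside `𝕊 4`, from four named facts already in the
tree** (universe `0`): gluing uniqueness (`hU`, Hirsch), Matveyev's part 1 with Fact 1 (`hB`),
Freedman–Quinn 11.1C (`hF`) and the Donaldson–Freedman–Wall exotic h-cobordant pair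
(`hD : Literature.Topology.FourManifolds.exists_isHCobordant_isEmpty_diffeomorph_four`), through
`exists_relExotic_fillings_sphere_of_partOneFact`. This is the sharpened scope statement of the
barrier audit (see the module docstring and the `scope_caveats:` / `evasions_known:` lines of
`RelativeContractibleBarrierFour`).
[cite: Matveyev1996, Theorem 1 part 1 and Fact 1 (arXiv:dg-ga/9505001 pp. 1, 3)]
[cite: AkbulutYasui2009Knotting, §7.2 (arXiv:0812.5098)] -/
theorem exists_relExotic_fillings_sphere_of_corkTheorem
    (hU : ∀ {C W : Type} [TopologicalSpace C] [T2Space C] [SecondCountableTopology C]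
      [ChartedSpace (EuclideanHalfSpace 4) C] [IsManifold (𝓡∂ 4) ∞ C] [CompactSpace C]
      [TopologicalSpace W] [T2Space W] [SecondCountableTopology W]
      [ChartedSpace (EuclideanHalfSpace 4) W] [IsManifold (𝓡∂ 4) ∞ W] [CompactSpace W]
      {bC : Literature.Topology.FourManifolds.BoundaryData (𝓡∂ 4) C (𝓡 3)} {bW : Literature.Topology.FourManifolds.BoundaryData (𝓡∂ 4) W (𝓡 3)}
      {X X' : Type}
      [TopologicalSpace X] [ChartedSpace (EuclideanSpace ℝ (Fin 4)) X] [IsManifold (𝓡 4) ∞ X]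
      [TopologicalSpace X'] [ChartedSpace (EuclideanSpace ℝ (Fin 4)) X'] [IsManifold (𝓡 4) ∞ X'],
      Literature.Topology.FourManifolds.nonempty_diffeomorph_of_isBoundaryGluing (bM := bC) (bN := bW) (P := X) (P' := X'))
    (hB : Literature.Topology.FourManifolds.Matveyev1996_partOne_and_fact.{0})
    (hF : freedmanQuinn1990_homeomorph_extends_contractible.{0})
    (hD : Literature.Topology.FourManifolds.exists_isHCobordant_isEmpty_diffeomorph_four) :
    ∃ (W₁ W₂ : Type)
      (_ : TopologicalSpace W₁) (_ : T2Space W₁) (_ : SecondCountableTopology W₁)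
      (_ : ChartedSpace (EuclideanHalfSpace 4) W₁) (_ : IsManifold (𝓡∂ 4) ∞ W₁)
      (_ : CompactSpace W₁) (_ : ContractibleSpace W₁)
      (_ : TopologicalSpace W₂) (_ : T2Space W₂) (_ : SecondCountableTopology W₂)
      (_ : ChartedSpace (EuclideanHalfSpace 4) W₂) (_ : IsManifold (𝓡∂ 4) ∞ W₂)
      (_ : CompactSpace W₂) (_ : ContractibleSpace W₂)
      (b₁ : Literature.Topology.FourManifolds.BoundaryData (𝓡∂ 4) W₁ (𝓡 3))
      (b₂ : Literature.Topology.FourManifolds.BoundaryData (𝓡∂ 4) W₂ (𝓡 3))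
      (ψ : b₁.carrier ≃ₘ⟮𝓡 3, 𝓡 3⟯ b₂.carrier),
      (∃ Φ : W₁ ≃ₜ W₂, ∀ x, Φ (b₁.incl x) = b₂.incl (ψ x)) ∧
      (¬ ∃ G : W₁ ≃ₘ⟮𝓡∂ 4, 𝓡∂ 4⟯ W₂, ∀ x, G (b₁.incl x) = b₂.incl (ψ x)) ∧
      Literature.Topology.FourManifolds.IsDouble b₁ (𝓡 4) (Metric.sphere (0 : EuclideanSpace ℝ (Fin (4 + 1))) 1) ∧
      Literature.Topology.FourManifolds.IsBoundaryGluing b₁ b₂ ψ (𝓡 4) (Metric.sphere (0 : EuclideanSpace ℝ (Fin (4 + 1))) 1) :=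
  exists_relExotic_fillings_sphere_of_partOneFact hU hB hF hD

/-! #### Knotting: the two piece embeddings `W₁ ↪ 𝕊 4` are inequivalent under `Diff(𝕊 4)` -/

section Knotting

variable {W₁ W₂ : Type u}
  [TopologicalSpace W₁] [ChartedSpace (EuclideanHalfSpace 4) W₁]
  [TopologicalSpace W₂] [ChartedSpace (EuclideanHalfSpace 4) W₂]
  {b₁ : Literature.Topology.FourManifolds.BoundaryData (𝓡∂ 4) W₁ (𝓡 3)}
  {b₂ : Literature.Topology.FourManifolds.BoundaryData (𝓡∂ 4) W₂ (𝓡 3)}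
  {S : Type*} [TopologicalSpace S] [ChartedSpace (EuclideanSpace ℝ (Fin 4)) S]
  [IsManifold (𝓡 4) ∞ S]

/-- **Relatively distinct complements knot the piece.** Let `S = W₁ ∪_{id} W₁` be realised by
piece maps `jA`, `jB : W₁ → S` and `S = W₁ ∪_ψ W₂` by `jA' : W₁ → S`, `jB' : W₂ → S` (the data of
two `IsClosedGluing` witnesses, written out). If a self-diffeomorphism `h` of `S` carried the
first embedding of `W₁` to the second, `h ∘ jA = jA'`, then `h` would map the complementary piece
onto the complementary piece, `range (h ∘ jB) = range jB'`, and two smooth embeddings with the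
same image differ by a diffeomorphism of their sources
(`Literature.Geometry.Manifold.exists_diffeomorph_comp_eq_of_range_eq`, Lee 2013, Thm. 5.31):
`G : W₁ ≅ W₂` with `jB' ∘ G = h ∘ jB`, which on the seam reads `G ∘ b₁.incl = b₂.incl ∘ ψ`. Hence
if `ψ` extends to no diffeomorphism `W₁ → W₂`, no such `h` exists: the two embeddings of `W₁` are
KNOTTED relative to each other (Akbulut–Yasui 2009, §7.2, for the corks `W_n ⊂ S⁴`).
[cite: AkbulutYasui2009Knotting, §7.2 (arXiv:0812.5098)] [cite: LeeSmoothManifolds2013, Thm. 5.31] -/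
theorem not_exists_diffeomorph_comp_eq_of_not_extends
    {jA jB : W₁ → S} (hB : Manifold.IsSmoothEmbedding (𝓡∂ 4) (𝓡 4) ∞ jB)
    (hcov : range jA ∪ range jB = univ)
    (hR : ∀ a b, jA a = jB b ↔ ∃ z, a = b₁.incl z ∧ b = b₁.incl z)
    {jA' : W₁ → S} {jB' : W₂ → S} (hB' : Manifold.IsSmoothEmbedding (𝓡∂ 4) (𝓡 4) ∞ jB')
    (hcov' : range jA' ∪ range jB' = univ) {ψ : b₁.carrier → b₂.carrier}
    (hR' : ∀ a b, jA' a = jB' b ↔ ∃ z, a = b₁.incl z ∧ b = b₂.incl (ψ z))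
    (hψ : ¬ ∃ G : W₁ ≃ₘ⟮𝓡∂ 4, 𝓡∂ 4⟯ W₂, ∀ x, G (b₁.incl x) = b₂.incl (ψ x)) :
    ¬ ∃ h : S ≃ₘ⟮𝓡 4, 𝓡 4⟯ S, ∀ w, h (jA w) = jA' w := by
  rintro ⟨h, hh⟩
  have hseam : ∀ z, jA (b₁.incl z) = jB (b₁.incl z) := fun z => (hR _ _).2 ⟨z, rfl, rfl⟩
  have hseam' : ∀ z, jA' (b₁.incl z) = jB' (b₂.incl (ψ z)) := fun z => (hR' _ _).2 ⟨z, rfl, rfl⟩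
  have hrange : range (h ∘ jB) = range jB' := by
    ext p
    constructor
    · rintro ⟨b, rfl⟩
      rcases (Set.eq_univ_iff_forall.1 hcov') (h (jB b)) with ⟨a, ha⟩ | ⟨b', hb'⟩
      · have hab : jA a = jB b := h.injective ((hh a).trans ha)
        obtain ⟨z, rfl, rfl⟩ := (hR _ _).1 hab
        exact ⟨b₂.incl (ψ z), (hseam' z).symm.trans ha⟩
      · exact ⟨b', hb'⟩
    · rintro ⟨b', rfl⟩
      rcases (Set.eq_univ_iff_forall.1 hcov) (h.symm (jB' b')) with ⟨a, ha⟩ | ⟨b, hb⟩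
      · have hab : jA' a = jB' b' := by rw [← hh, ha, Diffeomorph.apply_symm_apply]
        obtain ⟨z, rfl, hb'eq⟩ := (hR' _ _).1 hab
        refine ⟨b₁.incl z, ?_⟩
        show h (jB (b₁.incl z)) = jB' b'
        rw [← hseam, hh, hseam', hb'eq]
      · refine ⟨b, ?_⟩
        show h (jB b) = jB' b'
        rw [hb, Diffeomorph.apply_symm_apply]
  obtain ⟨Φ, hΦ⟩ := Literature.Geometry.Manifold.exists_diffeomorph_comp_eq_of_range_eq
    (hB.diffeomorph_comp h) hB' hrange
  refine hψ ⟨Φ, fun z => hB'.isEmbedding.injective ?_⟩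
  rw [hΦ, Function.comp_apply, ← hseam, hh, hseam']

end Knotting

/-- **The cork of an exotic pair knots in the standard 4-sphere** (universe polymorphic in the
pair). Under gluing uniqueness (`hU`), Matveyev's part 1 with Fact 1 (`hB`) and the existence of
an h-cobordant non-diffeomorphic simply connected closed pair (`hD`), there is a compact
(Hausdorff, second countable) contractible smooth 4-manifold `W₁` with two smooth embeddings
`j, j' : W₁ ↪ 𝕊 4` — the first-piece maps of `𝕊 4 = W₁ ∪_{id} W₁` and of `𝕊 4 = W₁ ∪_ψ W₂` —
such that NO self-diffeomorphism `h` of `𝕊 4` satisfies `h ∘ j = j'`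
(`not_exists_diffeomorph_comp_eq_of_not_extends` with
`not_exists_diffeomorph_extends_of_isEmpty_diffeomorph`). Akbulut–Yasui 2009, §7.2: *"The
corks `W_n` can be knotted in `S⁴` with simply connected complements (even PL knotted), this is
because doubling `W_n` both by the identity and by the involution `f_n : ∂W_n → ∂W_n` give `S⁴`,
and `f_n` takes a slice knot to a non-slice knot"*; here the detection is the exotic pair itself.
Consequently uniqueness of embeddings of compact contractible domains into `S⁴` up to
`Diff(S⁴)` fails relative to these facts (earlier knotted contractible 4-manifolds in `S⁴`:
Lickorish 2003, Livingston 2003, detected by `π₁` of the complement, loc. cit.).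
[cite: AkbulutYasui2009Knotting, §7.2 (arXiv:0812.5098)]
[cite: Matveyev1996, Theorem 1 part 1 and Fact 1 (arXiv:dg-ga/9505001 pp. 1, 3)] -/
theorem exists_knotted_contractible_sphere_of_partOneFact
    (hU : ∀ {C W : Type u} [TopologicalSpace C] [T2Space C] [SecondCountableTopology C]
      [ChartedSpace (EuclideanHalfSpace 4) C] [IsManifold (𝓡∂ 4) ∞ C] [CompactSpace C]
      [TopologicalSpace W] [T2Space W] [SecondCountableTopology W]
      [ChartedSpace (EuclideanHalfSpace 4) W] [IsManifold (𝓡∂ 4) ∞ W] [CompactSpace W]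
      {bC : Literature.Topology.FourManifolds.BoundaryData (𝓡∂ 4) C (𝓡 3)} {bW : Literature.Topology.FourManifolds.BoundaryData (𝓡∂ 4) W (𝓡 3)}
      {X X' : Type u}
      [TopologicalSpace X] [ChartedSpace (EuclideanSpace ℝ (Fin 4)) X] [IsManifold (𝓡 4) ∞ X]
      [TopologicalSpace X'] [ChartedSpace (EuclideanSpace ℝ (Fin 4)) X'] [IsManifold (𝓡 4) ∞ X'],
      Literature.Topology.FourManifolds.nonempty_diffeomorph_of_isBoundaryGluing (bM := bC) (bN := bW) (P := X) (P' := X'))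
    (hB : Literature.Topology.FourManifolds.Matveyev1996_partOne_and_fact.{u})
    (hD : ∃ (M N : Type u) (_ : TopologicalSpace M) (_ : T2Space M) (_ : SecondCountableTopology M)
      (_ : ChartedSpace (EuclideanSpace ℝ (Fin 4)) M) (_ : IsManifold (𝓡 4) ∞ M)
      (_ : CompactSpace M) (_ : SimplyConnectedSpace M)
      (_ : TopologicalSpace N) (_ : T2Space N) (_ : SecondCountableTopology N)
      (_ : ChartedSpace (EuclideanSpace ℝ (Fin 4)) N) (_ : IsManifold (𝓡 4) ∞ N)
      (_ : CompactSpace N) (_ : SimplyConnectedSpace N),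
      Literature.Topology.FourManifolds.IsHCobordant 4 M N ∧ IsEmpty (M ≃ₘ⟮𝓡 4, 𝓡 4⟯ N)) :
    ∃ (W₁ : Type u) (_ : TopologicalSpace W₁) (_ : T2Space W₁) (_ : SecondCountableTopology W₁)
      (_ : ChartedSpace (EuclideanHalfSpace 4) W₁) (_ : IsManifold (𝓡∂ 4) ∞ W₁)
      (_ : CompactSpace W₁) (_ : ContractibleSpace W₁) (j j' : W₁ → (Metric.sphere (0 : EuclideanSpace ℝ (Fin (4 + 1))) 1)),
      Manifold.IsSmoothEmbedding (𝓡∂ 4) (𝓡 4) ∞ j ∧ Manifold.IsSmoothEmbedding (𝓡∂ 4) (𝓡 4) ∞ j' ∧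
      ¬ ∃ h : (Metric.sphere (0 : EuclideanSpace ℝ (Fin (4 + 1))) 1) ≃ₘ⟮𝓡 4, 𝓡 4⟯ (Metric.sphere (0 : EuclideanSpace ℝ (Fin (4 + 1))) 1), ∀ w, h (j w) = j' w := by
  obtain ⟨M, N, _, _, _, _, _, _, _, _, _, _, _, _, _, _, hH, hne⟩ := hD
  obtain ⟨W₁, W₂, Q, _, _, _, _, _, _, _, _, _, _, _, _, _, _, _, b₁, b₂, bQ, φ₁, φ₂,
    hc₁, hk₁, -, -, hcQ, hX₁, hX₂, hDbl, hS⟩ := hB M N hH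
  haveI : CompactSpace W₁ := hc₁
  haveI : CompactSpace Q := hcQ
  have hψ : ∀ x, φ₂ ((φ₁.trans φ₂.symm) x) = φ₁ x := fun x => by simp
  have hnot := not_exists_diffeomorph_extends_of_isEmpty_diffeomorph hU hX₁ hX₂ hne hψ
  obtain ⟨jA, jB, hA, hB₁, hcov, hR⟩ := hDbl
  obtain ⟨jA', jB', hA', hB', hcov', hR'⟩ := hS
  have hR₀ : ∀ a b, jA a = jB b ↔ ∃ z, a = b₁.incl z ∧ b = b₁.incl z := by
    simpa only [id_eq] using hR
  exact ⟨W₁, ‹_›, ‹_›, ‹_›, ‹_›, ‹_›, hc₁, hk₁, jA, jA', hA, hA',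
    not_exists_diffeomorph_comp_eq_of_not_extends hB₁ hcov hR₀ hB' hcov' hR' hnot⟩

/-- **Knotted corks in `𝕊 4` from the tree's named facts** (universe `0`): gluing uniqueness
(`hU`), Matveyev's part 1 with Fact 1 (`hB`) and the Donaldson–Freedman–Wall exotic pair
(`hD`), through `exists_knotted_contractible_sphere_of_partOneFact`.
[cite: AkbulutYasui2009Knotting, §7.2 (arXiv:0812.5098)] -/
theorem exists_knotted_contractible_sphere_of_corkTheorem
    (hU : ∀ {C W : Type} [TopologicalSpace C] [T2Space C] [SecondCountableTopology C]
      [ChartedSpace (EuclideanHalfSpace 4) C] [IsManifold (𝓡∂ 4) ∞ C] [CompactSpace C]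
      [TopologicalSpace W] [T2Space W] [SecondCountableTopology W]
      [ChartedSpace (EuclideanHalfSpace 4) W] [IsManifold (𝓡∂ 4) ∞ W] [CompactSpace W]
      {bC : Literature.Topology.FourManifolds.BoundaryData (𝓡∂ 4) C (𝓡 3)} {bW : Literature.Topology.FourManifolds.BoundaryData (𝓡∂ 4) W (𝓡 3)}
      {X X' : Type}
      [TopologicalSpace X] [ChartedSpace (EuclideanSpace ℝ (Fin 4)) X] [IsManifold (𝓡 4) ∞ X]
      [TopologicalSpace X'] [ChartedSpace (EuclideanSpace ℝ (Fin 4)) X'] [IsManifold (𝓡 4) ∞ X'],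
      Literature.Topology.FourManifolds.nonempty_diffeomorph_of_isBoundaryGluing (bM := bC) (bN := bW) (P := X) (P' := X'))
    (hB : Literature.Topology.FourManifolds.Matveyev1996_partOne_and_fact.{0})
    (hD : Literature.Topology.FourManifolds.exists_isHCobordant_isEmpty_diffeomorph_four) :
    ∃ (W₁ : Type) (_ : TopologicalSpace W₁) (_ : T2Space W₁) (_ : SecondCountableTopology W₁)
      (_ : ChartedSpace (EuclideanHalfSpace 4) W₁) (_ : IsManifold (𝓡∂ 4) ∞ W₁)
      (_ : CompactSpace W₁) (_ : ContractibleSpace W₁) (j j' : W₁ → (Metric.sphere (0 : EuclideanSpace ℝ (Fin (4 + 1))) 1)),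
      Manifold.IsSmoothEmbedding (𝓡∂ 4) (𝓡 4) ∞ j ∧ Manifold.IsSmoothEmbedding (𝓡∂ 4) (𝓡 4) ∞ j' ∧
      ¬ ∃ h : (Metric.sphere (0 : EuclideanSpace ℝ (Fin (4 + 1))) 1) ≃ₘ⟮𝓡 4, 𝓡 4⟯ (Metric.sphere (0 : EuclideanSpace ℝ (Fin (4 + 1))) 1), ∀ w, h (j w) = j' w :=
  exists_knotted_contractible_sphere_of_partOneFact hU hB hD

end Literature.Barriers.SmoothPoincare4

end
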